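import Summits.ResolutionOfSingularities.ResolutionOfSingularities.Theorems.UniformComplexityCampaignW82TwistExponentCusp
import Mathlib.RingTheory.KrullDimension.NonZeroDivisors
import Mathlib.RingTheory.Spectrum.Prime.Topology
import HarnessLib

/-!
# [OURS · L1 W8.2] The twist-exponent witness, IV: non-prime base exponent, dimension, base change of `C_1`

Cell `res-hironaka`, LADDER-RESOLUTION rung L (RESCUE), slot W8.2, door 2 (`UniformComplexity`, host item
`PrimeModelTransfer` stmt-ResolutionOfSingularities-8933); prover res-L1-s82-pv-2 (gen 3). THESES-FREE module
(imports the sibling `…TwistExponentCusp`, Mathlib's Krull dimension of polynomial rings / quotients by a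
non-zero-divisor and `PrimeSpectrum.topologicalKrullDim_eq_ringKrullDim`, `HarnessLib`).

[OURS · L1 W8.2] Three technical complements on the curves `C_N : y^q = (x^P − t)^N` used by the rung
`…TwistExponentUnbounded`:
* §8 `prime_twistPoly'` / `isDomain_twistRing'`: primality of `X₀^q − (X₁^P − t)^N` for a base exponent
  `P ≥ 1` that need not be prime (`q` prime, `q ∤ P`, `q ∤ N`; needed with `P = p^m` and `P = 1`), and
  `topologicalKrullDim_twistCurve_le_one` (`dim K[x,y]/(f) ≤ 1` for `f ≠ 0`: `dim K[x,y] = 2`, `f` a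
  non-zero-divisor);
* §9 `pullbackTwistCurveIso φ : C_1(K,t) ×_{Spec K, φ} Spec L ≅ C_1(L, φ t)` for a ring map of fields
  `φ : K → L` (`pullbackSpecIso` + `tensorEquiv` + `Ideal.quotEquivOfEq`), with
  `pullbackTwistCurveIso_hom_comp` (it lies over `Spec L`); applied with `φ = Frob^e` (Frobenius twists) and
  with `φ : K → K^{perf}`.

HONEST FRAMING. OURS negative-side bookkeeping; NOT a statement of H. Hironaka's 2017 manuscript ([Hironaka2017]);
nothing here is attributed to its author. AI work, weaker than expert review.

## References (vocabulary and locators only)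
* U. Görtz, T. Wedhorn, *Algebraic Geometry I* (2nd ed. 2020), Thm. 5.32 / Prop. 5.30 (dimension of hypersurfaces). [GortzWedhorn2020]
-/

noncomputable section

set_option linter.dupNamespace false -- mandated namespace of this single-conjunct summit

open Polynomial
open scoped TensorProduct
open _root_.CategoryTheory _root_.CategoryTheory.Limits _root_.AlgebraicGeometry

namespace Summit.ResolutionOfSingularities.ResolutionOfSingularities.Theorems.CampaignW82.TwistExponent

open Literature.AlgebraicGeometry.Resolution

/-! ## §8 Base exponent not prime: `f = X₀^q − (X₁^P − t)^N` is prime for `q ∤ P`, `q ∤ N` -/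

section NonPrimeBase

variable (K : Type) [Field K] (P : ℕ) (t : K) (q : ℕ)

/-- `totalDegree ((X₀^P − t)^N) = N P` for `P ≥ 1` (as `totalDegree_base_pow`, without primality).
[folklore] -/
theorem totalDegree_base_pow' (hP : 0 < P) (N : ℕ) :
    ((MvPolynomial.X (0 : Fin 1) ^ P - MvPolynomial.C t : MvPolynomial (Fin 1) K) ^ N).totalDegree
      = N * P := by
  have hdeg : (MvPolynomial.X (0 : Fin 1) ^ P - MvPolynomial.C t : MvPolynomial (Fin 1) K).totalDegree
      = P := by
    rw [sub_eq_add_neg, ← map_neg, MvPolynomial.totalDegree_add_eq_left_of_totalDegree_lt]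
    · exact MvPolynomial.totalDegree_X_pow _ _
    · rw [MvPolynomial.totalDegree_C, MvPolynomial.totalDegree_X_pow]; exact hP
  have hne : (MvPolynomial.X (0 : Fin 1) ^ P - MvPolynomial.C t : MvPolynomial (Fin 1) K) ≠ 0 := by
    intro h
    have := congrArg MvPolynomial.totalDegree h
    rw [hdeg, MvPolynomial.totalDegree_zero] at this
    omega
  rw [totalDegree_pow_of_ne_zero hne, hdeg]

variable {K P t q}

/-- **`X₀^q − (X₁^P − t)^N` is prime** for a prime `q` with `q ∤ P`, `q ∤ N`, `P ≥ 1` (generalises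
`prime_twistPoly`, where `P = p` is prime; needed with `P = p^m` and `P = 1`). [folklore] -/
theorem prime_twistPoly' [hq : Fact q.Prime] (hP : 0 < P) (hqP : ¬ q ∣ P) {N : ℕ} (hqN : ¬ q ∣ N) :
    Prime (twistPoly K P t q N) := by
  have hq' : q.Prime := hq.out
  let a : MvPolynomial (Fin 1) K := (MvPolynomial.X 0 ^ P - MvPolynomial.C t) ^ N
  have ha : a ≠ 0 := by
    intro h
    have := congrArg MvPolynomial.totalDegree h
    rw [totalDegree_base_pow' K P t hP, MvPolynomial.totalDegree_zero] at this
    rcases Nat.mul_eq_zero.mp this with h0 | h0; exacts [hqN (h0 ▸ dvd_zero q), hP.ne' h0]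
  have hqa : ¬ q ∣ a.totalDegree := by
    rw [totalDegree_base_pow' K P t hP]; intro h
    rcases (Nat.Prime.dvd_mul hq').mp h with h1 | h1; exacts [hqN h1, hqP h1]
  have hprime : Prime (X ^ q - C a : (MvPolynomial (Fin 1) K)[X]) :=
    prime_X_pow_sub_C hq' a (forall_pow_ne_of_not_dvd_totalDegree hq' a ha hqa)
  refine (MulEquiv.prime_iff (MvPolynomial.finSuccEquiv K 1)).mp ?_
  rw [finSuccEquiv_twistPoly]
  exact hprime

/-- Hence `K[X₀,X₁]/(X₀^q − (X₁^P − t)^N)` is a domain (`q` prime, `q ∤ P`, `q ∤ N`, `P ≥ 1`). [folklore] -/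
theorem isDomain_twistRing' [Fact q.Prime] (hP : 0 < P) (hqP : ¬ q ∣ P) {N : ℕ} (hqN : ¬ q ∣ N) :
    IsDomain (TwistRing K P t q N) :=
  (Ideal.Quotient.isDomain_iff_prime _).mpr
    ((Ideal.span_singleton_prime (prime_twistPoly' hP hqP hqN).ne_zero).mpr (prime_twistPoly' hP hqP hqN))

/-- `dim C_N ≤ 1`: `K[X₀,X₁]` has dimension `2` and `f_N` is a non-zero-divisor. [folklore] -/
theorem topologicalKrullDim_twistCurve_le_one {N : ℕ} (hf : twistPoly K P t q N ≠ 0) :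
    topologicalKrullDim ↥(twistCurve K P t q N) ≤ 1 := by
  change topologicalKrullDim (PrimeSpectrum (TwistRing K P t q N)) ≤ 1
  rw [PrimeSpectrum.topologicalKrullDim_eq_ringKrullDim]
  have h := ringKrullDim_quotient_succ_le_of_nonZeroDivisor (mem_nonZeroDivisors_of_ne_zero hf)
  rw [MvPolynomial.ringKrullDim_of_isNoetherianRing, ringKrullDim_eq_zero_of_field] at h
  -- `h : dim + 1 ≤ 0 + 2`
  revert h
  generalize ringKrullDim (TwistRing K P t q N) = d
  intro h
  induction d using WithBot.recBotCoe with
  | bot => exact bot_le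
  | coe d =>
    induction d using ENat.recTopCoe with
    | top => exact absurd h (by decide)
    | coe d =>
      have : (d : WithBot ℕ∞) + 1 ≤ (2 : ℕ) := by simpa using h
      have h' : d + 1 ≤ 2 := by exact_mod_cast this
      exact_mod_cast (show d ≤ 1 by omega)

end NonPrimeBase

/-! ## §9 Base change of `C_1` along a ring map of fields `φ : K → L` -/

section BaseChange

variable (K : Type) [Field K] (P : ℕ) (t : K) (q : ℕ) {L : Type} [Field L]

/-- With `L` a `K`-algebra: `f_L = f_1` read over `L`, so `A_{1,L} = A_1(L, φ t)`. [folklore] -/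
def extEquiv [Algebra K L] : TwistRingExt K P t q L ≃+* TwistRing L P (algebraMap K L t) q 1 :=
  Ideal.quotEquivOfEq (by rw [twistPolyExt_eq, twistPoly, pow_one])

/-- `extEquiv` on representatives. [folklore] -/
theorem extEquiv_mk [Algebra K L] (x : MvPolynomial (Fin 2) L) :
    extEquiv K P t q (L := L) (Ideal.Quotient.mk _ x) = Ideal.Quotient.mk _ x :=
  Ideal.quotEquivOfEq_mk _ _

/-- **Base change of the curve `C_1(K, t)` along `φ : K → L` is `C_1(L, φ t)`**:
`C_1 ×_{Spec K, φ} Spec L ≅ Spec (A_1 ⊗_K L) ≅ Spec A_{1,L} ≅ Spec L[x,w]/(w^q − (x^P − φ t))`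
(`pullbackSpecIso`, `tensorEquiv`, `extEquiv`). [folklore] -/
def pullbackTwistCurveIso (φ : K →+* L) :
    pullback (twistCurveTo K P t q 1) (Spec.map (CommRingCat.ofHom φ)) ≅ twistCurve L P (φ t) q 1 :=
  letI : Algebra K L := φ.toAlgebra
  pullbackSpecIso K (TwistRing K P t q 1) L ≪≫
    Scheme.Spec.mapIso ((tensorEquiv K P t q L).symm.toCommRingCatIso).op ≪≫
    Scheme.Spec.mapIso ((extEquiv K P t q (L := L)).symm.toCommRingCatIso).op

/-- The base-change isomorphism lies over `Spec L`. [folklore] -/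
theorem pullbackTwistCurveIso_hom_comp (φ : K →+* L) :
    (pullbackTwistCurveIso K P t q φ).hom ≫ twistCurveTo L P (φ t) q 1 =
      pullback.snd (twistCurveTo K P t q 1) (Spec.map (CommRingCat.ofHom φ)) := by
  letI : Algebra K L := φ.toAlgebra
  have key : (CommRingCat.ofHom (algebraMap L (TwistRing L P (φ t) q 1))) ≫
      ((extEquiv K P t q (L := L)).symm.toCommRingCatIso).hom ≫
        ((tensorEquiv K P t q L).symm.toCommRingCatIso).hom =
      CommRingCat.ofHom (R := L) (S := TwistRing K P t q 1 ⊗[K] L)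
        (Algebra.TensorProduct.includeRight.toRingHom) := by
    ext l
    change (tensorEquiv K P t q L).symm ((extEquiv K P t q (L := L)).symm
      (algebraMap L (TwistRing L P (φ t) q 1) l)) = (1 : TwistRing K P t q 1) ⊗ₜ[K] l
    apply (tensorEquiv K P t q L).injective
    rw [RingEquiv.apply_symm_apply]
    apply (extEquiv K P t q (L := L)).injective
    rw [RingEquiv.apply_symm_apply]
    have h1 : tensorEquiv K P t q L ((1 : TwistRing K P t q 1) ⊗ₜ[K] l) =
        algebraMap L (TwistRingExt K P t q L) l := by
      change tensorEquivL K P t q L ((Algebra.TensorProduct.comm K (TwistRing K P t q 1) L) (1 ⊗ₜ l)) = _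
      have h0 : ∀ x : L, x ⊗ₜ[K] (1 : TwistRing K P t q 1) = x • ((1 : L) ⊗ₜ[K] (1 : TwistRing K P t q 1)) :=
        fun x => by rw [TensorProduct.smul_tmul', smul_eq_mul, mul_one]
      rw [Algebra.TensorProduct.comm_tmul, h0, map_smul, ← Algebra.TensorProduct.one_def, map_one,
        ← Algebra.algebraMap_eq_smul_one]
    rw [h1]
    change Ideal.Quotient.mk _ (MvPolynomial.C l) =
      extEquiv K P t q (L := L) (Ideal.Quotient.mk _ (MvPolynomial.C l))
    rw [extEquiv_mk]
  rw [show (pullbackTwistCurveIso K P t q φ).hom = (pullbackSpecIso K (TwistRing K P t q 1) L).hom ≫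
      Spec.map ((tensorEquiv K P t q L).symm.toCommRingCatIso).hom ≫
        Spec.map ((extEquiv K P t q (L := L)).symm.toCommRingCatIso).hom from rfl]
  rw [Category.assoc, Category.assoc, ← Spec.map_comp, ← Spec.map_comp]
  simp only [Category.assoc]
  rw [key]
  exact pullbackSpecIso_hom_snd K (TwistRing K P t q 1) L

end BaseChange


end Summit.ResolutionOfSingularities.ResolutionOfSingularities.Theorems.CampaignW82.TwistExponent

end
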